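import Literature.NumberTheory.EllipticCurves.CanonicalPAdicHeightLeavesProofs
import HarnessLib

/-!
# The canonical `p`-adic height over a number field `K`: the admissible locus is a subgroup and
# `E₁` at an embedding is torsion-free

Trunk T-NT-EC (Literature/NumberTheory/EllipticCurves); first proof file behind the named fact
`WeierstrassCurve.exists_isCanonicalK` of `CanonicalPAdicHeight.lean` (existence of the canonical
cyclotomic `p`-adic height datum on `E(K)` for `p ≥ 5` good ordinary and TOTALLY SPLIT in the number
field `K`, whose quadratic form on admissible points is the sigma formula
`ĥ_{p,K}(P) = log_p N𝔡(x(P)) - 2 Σ_{ι : K → ℚ_p} log_p σ_p(z(ιP))`, Balakrishnan–Çiperiani–Stein 2015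
§4.1 eq. (4.1) after Mazur–Stein–Tate 2006 §2.8, in the Stein–Wuthrich normalisation). The
`ℚ`-version `exists_isCanonical` has been reduced in the tree to the two named facts
`mazur_tate_sigma_existsUnique` (MST 2006 Thm. 1.3) and `padicSigma_theta_formal` (Mazur–Tate 1991
Thm. 3.1 / Blakestad–Grant 2023 Prop. 14) (`exists_isCanonical_of_MT_theta`,
`FormalGroupLawPadicProofs.lean`); the three `…K…Proofs` files do the same for the `K`-version,
following the printed argument of MST 2006 §2.6–2.8 place by place over `K`. This file supplies
the group-theoretic inputs over `K` (AEC VII.2.1–2.2, VII.3), all PROVED: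

* `embValuation ι` — the absolute value `‖ι ·‖_p` of `K` at an embedding `ι : K → ℚ_p` (for `p`
  totally split these are the places of `K` above `p`), as an `ℝ≥0`-valued valuation;
* `intModel`, `embIntModel`, `placeIntModel` — the equation `W ⊗ K` (`W/ℚ` with integer coefficients)
  regarded over the valuation ring of `‖ι ·‖_p`, resp. of a finite place `v`, so that
  `ReductionHomomorphism.lean` (AEC VII.2.1 for an arbitrary valuation ring) applies; the base
  change back to `K` is `W ⊗ K` by `rfl`;
* `kernelOfReductionAtEmb W K ι` (`E(K) ∩ E₁` at `ι`: `O` and `‖ι x‖_p > 1`) and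
  `nonsingularReductionSubgroupAtPlace W K v` (`E₀` at `v`) as subgroups of `E(K)`, with the
  dictionary `hasNonsingularReduction_placeIntModel_iff` to the coordinate predicate
  `HasNonsingularReductionAtK` of `CanonicalPAdicHeight.lean`;
* `inSigmaDisc_of_one_lt_norm_emb` (`‖z(ιP)‖ ≤ p⁻¹ < p^{-1/(p-1)}` on `E₁`, `p` odd) and
  `exists_addSubgroup_coe_eq_localConditionsLocusK` — **the admissible locus over `K` with `O` is
  the subgroup `(⨅_ι E₁ at ι) ⊓ (⨅_v E₀ at v)`** (`p ≠ 2`);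
* `not_isOfFinAddOrder_of_one_lt_norm_emb` — **`E(K) ∩ E₁` at `ι` is torsion-free for `p` odd**
  (AEC VII.3.4 / IV.6.1), by division polynomials exactly as the `ℚ`-case
  `not_isOfFinAddOrder_of_one_lt_padicNorm_holds` (`CanonicalPAdicHeightLeavesProofs.lean`).

## Sources

* J. H. Silverman, *The Arithmetic of Elliptic Curves*, 2nd ed. (2009): VII.2 Prop. 2.1, 2.2
  (PDF pp. 166–170 of the held copy), VII.3.1, VII.3.4, IV.6.1, Exercise 3.7.
* B. Mazur, W. Stein, J. Tate, *Computation of `p`-adic heights and log convergence*, Doc. Math.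
  Extra Vol. Coates (2006), §2.2 ("good representation": same component at all `v`, reducing to
  `0` at `v ∣ p`), §2.8 (read: PDF pp. 7–10 of the held copy).
* J. Balakrishnan, M. Çiperiani, W. Stein, Math. Comp. 84 (2015), §4.1 (conditions (1), (2) on
  `P`; not held — statement as transcribed in `CanonicalPAdicHeight.lean`).

## Design notes

* Curve statements are deliberate dot-notation extensions of Mathlib's `WeierstrassCurve`
  namespace only where the sibling files already put them; everything generic is in
  `Literature.NumberTheory.EllipticCurves`.
* For a variable number field `K` the only `DecidableEq K` instance is the classical one, so the
  subgroups of `ReductionHomomorphism.lean` are rebuilt on `E(K) = (W ⊗ K).toAffine.Point` by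
  `carrier` + closure lemmas without any instance transport (contrast `point_add_irrel` for `ℚ`).
* `K : Type` (universe `0`) as in `PAdicHeightsK.lean` / `CanonicalPAdicHeight.lean`.
-/

noncomputable section

open scoped Classical NNReal
open IsDedekindDomain NumberField

namespace Literature.NumberTheory.EllipticCurves

/-! ### The `p`-adic absolute value of `K` at an embedding `ι : K → ℚ_p` -/

section EmbeddingValuation

variable {K : Type*} [Field K] {p : ℕ} [Fact p.Prime] (ι : K →+* ℚ_[p])

/-- The absolute value `x ↦ ‖ι x‖_p` of `K` at an embedding `ι : K → ℚ_p`, as an `ℝ≥0`-valued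
valuation (pull-back of the norm valuation of `ℚ_p`; for `p` totally split in a number field `K`
these are the places of `K` above `p`). [folklore] -/
def embValuation : Valuation K ℝ≥0 :=
  NormedField.valuation.comap ι

/-- `embValuation ι x = ‖ι x‖_p`. [folklore] -/
@[simp] theorem embValuation_apply (x : K) : embValuation ι x = ‖ι x‖₊ := rfl

/-- `1 < embValuation ι x ↔ 1 < ‖ι x‖`. [folklore] -/
theorem one_lt_embValuation_iff (x : K) : 1 < embValuation ι x ↔ 1 < ‖ι x‖ := by
  rw [embValuation_apply, ← NNReal.coe_lt_coe, NNReal.coe_one, coe_nnnorm]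

/-- `embValuation ι x ≤ 1 ↔ ‖ι x‖ ≤ 1`. [folklore] -/
theorem embValuation_le_one_iff (x : K) : embValuation ι x ≤ 1 ↔ ‖ι x‖ ≤ 1 := by
  rw [embValuation_apply, ← NNReal.coe_le_coe, NNReal.coe_one, coe_nnnorm]

/-- Integers have absolute value `≤ 1`. [folklore] -/
theorem embValuation_intCast_le_one (m : ℤ) : embValuation ι (m : K) ≤ 1 := by
  rw [embValuation_le_one_iff, map_intCast]
  exact Padic.norm_int_le_one m

end EmbeddingValuation

/-! ### Integral models of `W ⊗ K` over valuation rings of `K` -/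

section IntModel

variable (W : WeierstrassCurve ℚ) [W.IsIntegral ℤ] (K : Type*) [Field K] [NumberField K]

/-- The coefficients of `W ⊗ K` are (images of) rational integers. [folklore] -/
theorem exists_intCast_eq_baseChange :
    ∃ m₁ m₂ m₃ m₄ m₆ : ℤ, (W.baseChange K).a₁ = m₁ ∧ (W.baseChange K).a₂ = m₂ ∧
      (W.baseChange K).a₃ = m₃ ∧ (W.baseChange K).a₄ = m₄ ∧ (W.baseChange K).a₆ = m₆ := by
  refine ⟨(W.integralModel ℤ).a₁, (W.integralModel ℤ).a₂, (W.integralModel ℤ).a₃,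
    (W.integralModel ℤ).a₄, (W.integralModel ℤ).a₆, ?_, ?_, ?_, ?_, ?_⟩ <;>
  simp only [WeierstrassCurve.baseChange, WeierstrassCurve.map_a₁, WeierstrassCurve.map_a₂,
    WeierstrassCurve.map_a₃, WeierstrassCurve.map_a₄, WeierstrassCurve.map_a₆,
    ← WeierstrassCurve.integralModel_a₁_eq ℤ W, ← WeierstrassCurve.integralModel_a₂_eq ℤ W,
    ← WeierstrassCurve.integralModel_a₃_eq ℤ W, ← WeierstrassCurve.integralModel_a₄_eq ℤ W,
    ← WeierstrassCurve.integralModel_a₆_eq ℤ W, eq_intCast, map_intCast]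

variable {Γ₀ : Type*} [LinearOrderedCommGroupWithZero Γ₀] (w : Valuation K Γ₀)

/-- The coefficients of `W ⊗ K` are `w`-integral for every valuation `w` bounded by `1` on `ℤ`.
[folklore] -/
theorem valuation_coeff_baseChange_le_one (hw : ∀ m : ℤ, w (m : K) ≤ 1) :
    w (W.baseChange K).a₁ ≤ 1 ∧ w (W.baseChange K).a₂ ≤ 1 ∧ w (W.baseChange K).a₃ ≤ 1 ∧
      w (W.baseChange K).a₄ ≤ 1 ∧ w (W.baseChange K).a₆ ≤ 1 := by
  obtain ⟨m₁, m₂, m₃, m₄, m₆, h₁, h₂, h₃, h₄, h₆⟩ := exists_intCast_eq_baseChange W K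
  rw [h₁, h₂, h₃, h₄, h₆]
  exact ⟨hw _, hw _, hw _, hw _, hw _⟩

/-- **The integral model of `W ⊗ K` over the valuation ring of `w`**: the same equation with
coefficients regarded in `{x | w x ≤ 1}` (a local ring), so that `ReductionHomomorphism.lean`
applies; its base change to `K` is `W ⊗ K` definitionally. [Silverman AEC VII.1–VII.2] [folklore] -/
def intModel (hw : ∀ m : ℤ, w (m : K) ≤ 1) : WeierstrassCurve (w.valuationSubring) :=
  ⟨⟨(W.baseChange K).a₁, (valuation_coeff_baseChange_le_one W K w hw).1⟩,
    ⟨(W.baseChange K).a₂, (valuation_coeff_baseChange_le_one W K w hw).2.1⟩,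
    ⟨(W.baseChange K).a₃, (valuation_coeff_baseChange_le_one W K w hw).2.2.1⟩,
    ⟨(W.baseChange K).a₄, (valuation_coeff_baseChange_le_one W K w hw).2.2.2.1⟩,
    ⟨(W.baseChange K).a₆, (valuation_coeff_baseChange_le_one W K w hw).2.2.2.2⟩⟩

/-- `(intModel) ⊗ K = W ⊗ K` (by `rfl`). [folklore] -/
theorem intModel_baseChange (hw : ∀ m : ℤ, w (m : K) ≤ 1) :
    (intModel W K w hw).baseChange K = W.baseChange K := rfl

end IntModel

/-- The valuation ring of `w` is its ring of integers (hypothesis `hv` of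
`ReductionHomomorphism.lean`). [folklore] -/
theorem valuation_integers_valuationSubring {K : Type*} [Field K] {Γ₀ : Type*}
    [LinearOrderedCommGroupWithZero Γ₀] (w : Valuation K Γ₀) : w.Integers w.valuationSubring :=
  Valuation.valuationSubring.integers _

/-! ### `E₁` at an embedding and `E₀` at a finite place, as subgroups of `E(K)` -/

section Subgroups

variable (W : WeierstrassCurve ℚ) [W.IsIntegral ℤ] (K : Type) [Field K] [NumberField K]
  {p : ℕ} [Fact p.Prime]

/-- Integers have `v`-adic valuation `≤ 1` at a finite place `v`. [folklore] -/
theorem heightOneSpectrum_valuation_intCast_le_one (v : HeightOneSpectrum (𝓞 K)) (m : ℤ) :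
    v.valuation K (m : K) ≤ 1 := by
  have : (m : K) = algebraMap (𝓞 K) K (m : 𝓞 K) := by simp
  rw [this]; exact v.valuation_le_one _

/-- The integral model of `W ⊗ K` at the embedding `ι : K → ℚ_p` (valuation ring of `‖ι ·‖_p`).
[folklore] -/
abbrev embIntModel (ι : K →+* ℚ_[p]) : WeierstrassCurve (embValuation ι).valuationSubring :=
  intModel W K (embValuation ι) (embValuation_intCast_le_one ι)

/-- The integral model of `W ⊗ K` at the finite place `v` (valuation ring of `v`). [folklore] -/
abbrev placeIntModel (v : HeightOneSpectrum (𝓞 K)) :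
    WeierstrassCurve (v.valuation K).valuationSubring :=
  intModel W K (v.valuation K) (heightOneSpectrum_valuation_intCast_le_one K v)

/-- **`E(K) ∩ E₁` at the embedding `ι : K → ℚ_p`** — `O` and the points with `‖ι x‖_p > 1` — as a
subgroup of `E(K)` (AEC VII.2.1–2.2 for the integral model over the valuation ring of `‖ι ·‖_p`,
`ReducesToZero.add/.neg` of `ReductionHomomorphism.lean`). [Silverman AEC VII.2.2]
[cite: SilvermanAEC2009, VII.2.2] -/
def kernelOfReductionAtEmb (ι : K →+* ℚ_[p]) : AddSubgroup (W.baseChange K).toAffine.Point where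
  carrier := {P | WeierstrassCurve.ReducesToZero (K := K) (embIntModel W K ι) P}
  zero_mem' := WeierstrassCurve.reducesToZero_zero (K := K) (W := embIntModel W K ι)
  add_mem' hP hQ := WeierstrassCurve.ReducesToZero.add (valuation_integers_valuationSubring _) hP hQ
  neg_mem' hP := WeierstrassCurve.ReducesToZero.neg hP

variable {W K} in
/-- Membership in `E₁` at `ι`, unfolded. [folklore] -/
theorem mem_kernelOfReductionAtEmb_iff (ι : K →+* ℚ_[p]) (P : (W.baseChange K).toAffine.Point) :
    P ∈ kernelOfReductionAtEmb W K ι ↔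
      WeierstrassCurve.ReducesToZero (K := K) (embIntModel W K ι) P := Iff.rfl

variable {W K} in
/-- Membership of an affine point in `E₁` at `ι`: `‖ι x‖_p > 1`. [Silverman AEC VII.2] [folklore] -/
theorem some_mem_kernelOfReductionAtEmb_iff (ι : K →+* ℚ_[p]) {x y : K}
    (h : (W.baseChange K).toAffine.Nonsingular x y) :
    (.some x y h : (W.baseChange K).toAffine.Point) ∈ kernelOfReductionAtEmb W K ι ↔ 1 < ‖ι x‖ := by
  rw [mem_kernelOfReductionAtEmb_iff]
  exact (WeierstrassCurve.reducesToZero_some_iff (W := embIntModel W K ι) h).trans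
    ((not_mem_range_iff (valuation_integers_valuationSubring _)).trans (one_lt_embValuation_iff ι x))

/-- **`E₀` at the finite place `v` of `K`** — the points of `E(K)` with non-singular reduction at
`v` — as a subgroup of `E(K)` (AEC VII.2.1 for the integral model over the valuation ring of `v`,
`HasNonsingularReduction.add/.neg` of `ReductionHomomorphism.lean`). [Silverman AEC VII.2.1]
[cite: SilvermanAEC2009, VII.2.1] -/
def nonsingularReductionSubgroupAtPlace (v : HeightOneSpectrum (𝓞 K)) :
    AddSubgroup (W.baseChange K).toAffine.Point where
  carrier := {P | WeierstrassCurve.HasNonsingularReduction (K := K) (placeIntModel W K v) P}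
  zero_mem' := WeierstrassCurve.hasNonsingularReduction_zero (K := K) (W := placeIntModel W K v)
  add_mem' hP hQ :=
    WeierstrassCurve.HasNonsingularReduction.add (valuation_integers_valuationSubring _) hP hQ
  neg_mem' hP := WeierstrassCurve.HasNonsingularReduction.neg hP

variable {W K} in
/-- Membership in `E₀` at `v`, unfolded. [folklore] -/
theorem mem_nonsingularReductionSubgroupAtPlace_iff (v : HeightOneSpectrum (𝓞 K))
    (P : (W.baseChange K).toAffine.Point) :
    P ∈ nonsingularReductionSubgroupAtPlace W K v ↔
      WeierstrassCurve.HasNonsingularReduction (K := K) (placeIntModel W K v) P := Iff.rfl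

variable {W K} in
/-- **`E₀` at `v` in coordinates.** An affine point `(x, y)` of `E(K)` has non-singular reduction at
the finite place `v` in the sense of `ReductionHomomorphism.lean` (for the integral model over the
valuation ring of `v`) iff `HasNonsingularReductionAtK v x y` (`|x|_v > 1`, or `Φ_x` or `Φ_y` a
`v`-adic unit). [Silverman AEC VII.2 (definition of `E₀`)] [folklore] -/
theorem hasNonsingularReduction_placeIntModel_iff (v : HeightOneSpectrum (𝓞 K)) {x y : K}
    (h : (W.baseChange K).toAffine.Nonsingular x y) :
    WeierstrassCurve.HasNonsingularReduction (K := K) (placeIntModel W K v) (.some x y h) ↔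
      W.HasNonsingularReductionAtK K v x y := by
  set R := (v.valuation K).valuationSubring with hR
  have hv : (v.valuation K).Integers R := valuation_integers_valuationSubring _
  have hinj : Function.Injective (algebraMap R K) := hv.hom_inj
  have hunit : ∀ a : R, IsLocalRing.residue R a ≠ 0 ↔ v.valuation K (algebraMap R K a) = 1 :=
    fun a => (v_algebraMap_eq_one_iff hv a).symm
  have hout : x ∉ Set.range (algebraMap R K) ↔ 1 < v.valuation K x := not_mem_range_iff hv
  have ha₁ : algebraMap R K (placeIntModel W K v).a₁ = (W.baseChange K).a₁ := rfl
  have ha₂ : algebraMap R K (placeIntModel W K v).a₂ = (W.baseChange K).a₂ := rfl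
  have ha₃ : algebraMap R K (placeIntModel W K v).a₃ = (W.baseChange K).a₃ := rfl
  have ha₄ : algebraMap R K (placeIntModel W K v).a₄ = (W.baseChange K).a₄ := rfl
  -- the two non-singularity conditions agree on integral points
  have key : ∀ x₀ y₀ : R,
      ((placeIntModel W K v).map (IsLocalRing.residue R)).toAffine.polynomialX.evalEval
          (IsLocalRing.residue R x₀) (IsLocalRing.residue R y₀) ≠ 0 ∨
        ((placeIntModel W K v).map (IsLocalRing.residue R)).toAffine.polynomialY.evalEval
          (IsLocalRing.residue R x₀) (IsLocalRing.residue R y₀) ≠ 0 ↔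
      v.valuation K ((W.baseChange K).toAffine.polynomialX.evalEval (algebraMap R K x₀)
          (algebraMap R K y₀)) = 1 ∨
        v.valuation K ((W.baseChange K).toAffine.polynomialY.evalEval (algebraMap R K x₀)
          (algebraMap R K y₀)) = 1 := by
    intro x₀ y₀
    have hΦx : algebraMap R K (3 * x₀ ^ 2 + 2 * (placeIntModel W K v).a₂ * x₀ +
        (placeIntModel W K v).a₄ - (placeIntModel W K v).a₁ * y₀) =
          -((W.baseChange K).toAffine.polynomialX.evalEval (algebraMap R K x₀)
            (algebraMap R K y₀)) := by
      rw [WeierstrassCurve.Affine.evalEval_polynomialX]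
      simp only [map_sub, map_add, map_mul, map_pow, map_ofNat, ha₁, ha₂, ha₄]
      ring
    have hΦy : algebraMap R K (y₀ - (placeIntModel W K v).toAffine.negY x₀ y₀) =
        (W.baseChange K).toAffine.polynomialY.evalEval (algebraMap R K x₀) (algebraMap R K y₀) := by
      rw [WeierstrassCurve.Affine.evalEval_polynomialY, WeierstrassCurve.Affine.negY]
      simp only [map_sub, map_neg, map_mul, ha₁, ha₃]
      ring
    have ex := residue_polynomialX (W := placeIntModel W K v) x₀ y₀
    have ey := residue_polynomialY (W := placeIntModel W K v) x₀ y₀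
    have kx : ((placeIntModel W K v).map (IsLocalRing.residue R)).toAffine.polynomialX.evalEval
          (IsLocalRing.residue R x₀) (IsLocalRing.residue R y₀) ≠ 0 ↔
        v.valuation K ((W.baseChange K).toAffine.polynomialX.evalEval (algebraMap R K x₀)
          (algebraMap R K y₀)) = 1 := by
      rw [← neg_ne_zero, ← ex, hunit, hΦx, Valuation.map_neg]
    have ky : ((placeIntModel W K v).map (IsLocalRing.residue R)).toAffine.polynomialY.evalEval
          (IsLocalRing.residue R x₀) (IsLocalRing.residue R y₀) ≠ 0 ↔
        v.valuation K ((W.baseChange K).toAffine.polynomialY.evalEval (algebraMap R K x₀)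
          (algebraMap R K y₀)) = 1 := by
      rw [← ey, hunit, hΦy]
    rw [kx, ky]
  unfold WeierstrassCurve.HasNonsingularReductionAtK
  constructor
  · rintro (hx | ⟨x₀, y₀, rfl, rfl, hns⟩)
    · exact Or.inl (hout.mp hx)
    · exact Or.inr ((key x₀ y₀).mp hns.2)
  · intro hxy
    by_cases hx : x ∈ Set.range (algebraMap R K)
    · obtain ⟨x₀, rfl⟩ := hx
      have h1 : ((placeIntModel W K v).baseChange K).toAffine.Equation (algebraMap R K x₀) y := h.1
      have hy : v.valuation K y ≤ 1 := v_Y_le_one_of_v_X_le_one hv h1 (hv.map_le_one x₀)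
      obtain ⟨y₀, rfl⟩ := hv.exists_of_le_one hy
      have h2 : (placeIntModel W K v).toAffine.Equation x₀ y₀ :=
        (map_equation_iff (W := placeIntModel W K v) hinj).mp h1
      refine Or.inr ⟨x₀, y₀, rfl, rfl, h2.map _, (key x₀ y₀).mpr (hxy.resolve_left fun hlt => ?_)⟩
      exact (hout.mpr hlt) ⟨x₀, rfl⟩
    · exact Or.inl hx

variable {W K} in
/-- Membership of an affine point in `E₀` at `v`: `HasNonsingularReductionAtK`. [folklore] -/
theorem some_mem_nonsingularReductionSubgroupAtPlace_iff (v : HeightOneSpectrum (𝓞 K)) {x y : K}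
    (h : (W.baseChange K).toAffine.Nonsingular x y) :
    (.some x y h : (W.baseChange K).toAffine.Point) ∈ nonsingularReductionSubgroupAtPlace W K v ↔
      W.HasNonsingularReductionAtK K v x y :=
  hasNonsingularReduction_placeIntModel_iff v h

/-! ### The admissible locus over `K` (with `O`) is a subgroup, for `p` odd -/

variable {W K} in
/-- **Points of `E₁` at `ι` have parameter in the sigma disc (`p` odd)**: for `P = (x, y) ∈ E(K)`
with `‖ι x‖_p > 1` one has `ι y ≠ 0` and `‖z(ιP)‖ = ‖ι x/ι y‖ ≤ p⁻¹ < p^{-1/(p-1)}`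
(AEC VII.2.2: `3v(x) = 2v(y)`). [Silverman AEC VII.2.2; Stein–Wuthrich 2013, §4] [folklore] -/
theorem inSigmaDisc_of_one_lt_norm_emb (hp : p ≠ 2) (ι : K →+* ℚ_[p]) {x y : K}
    (h : (W.baseChange K).toAffine.Nonsingular x y) (hx : 1 < ‖ι x‖) :
    ι y ≠ 0 ∧ WeierstrassCurve.InSigmaDisc p (-ι x / ι y) := by
  have hv := valuation_integers_valuationSubring (embValuation ι)
  have h1 : ((embIntModel W K ι).baseChange K).toAffine.Equation x y := h.1
  have hx' : 1 < embValuation ι x := (one_lt_embValuation_iff ι x).mpr hx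
  obtain ⟨hy, hz, -, -, -⟩ := v_zw_of_one_lt hv h1 hx'
  rw [embValuation_apply, ← NNReal.coe_lt_coe, NNReal.coe_one, coe_nnnorm, map_div₀, map_neg] at hz
  have hy' : ι y ≠ 0 := (map_ne_zero ι).mpr hy
  refine ⟨hy', ?_⟩
  unfold WeierstrassCurve.InSigmaDisc
  have hp1 : (1 : ℝ) < p := by exact_mod_cast (Fact.out : p.Prime).one_lt
  have hp2 : (2 : ℝ) < p := by
    have h2 : 2 < p := lt_of_le_of_ne (Fact.out : p.Prime).two_le (Ne.symm hp)
    exact_mod_cast h2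
  have hlt : (p : ℝ)⁻¹ < (p : ℝ) ^ (-(1 / ((p : ℝ) - 1))) := by
    rw [← Real.rpow_neg_one, Real.rpow_lt_rpow_left_iff hp1, neg_lt_neg_iff,
      div_lt_one (by linarith)]
    linarith
  refine lt_of_le_of_lt ?_ hlt
  by_cases hz0 : -ι x / ι y = 0
  · rw [hz0, norm_zero]; positivity
  · rw [Padic.norm_eq_zpow_neg_valuation hz0] at hz ⊢
    have hval : 0 < (-ι x / ι y).valuation := by
      by_contra hle
      exact (one_le_zpow₀ hp1.le (by omega)).not_gt hz
    calc (p : ℝ) ^ (-(-ι x / ι y).valuation) ≤ (p : ℝ) ^ (-1 : ℤ) :=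
          zpow_le_zpow_right₀ hp1.le (by omega)
      _ = (p : ℝ)⁻¹ := zpow_neg_one _

/-- **The admissible locus over `K` with `O` is a subgroup of `E(K)` (`p` odd).** For `W/ℚ` with
integer coefficients, a number field `K` and a prime `p ≠ 2`,
`{O} ∪ {P | SatisfiesLocalConditionsK p K P}` is the underlying set of the subgroup
`(⨅_ι E₁ at ι) ⊓ (⨅_v E₀ at v)` (AEC VII.2.1–2.2 through the integral models; the sigma-disc
condition is implied by `‖ι x‖ > 1` for odd `p`). [Silverman AEC VII.2.1, VII.2.2;
Balakrishnan–Çiperiani–Stein 2015, §4.1 (conditions (1), (2))] [cite: SilvermanAEC2009, VII.2.1] -/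
theorem exists_addSubgroup_coe_eq_localConditionsLocusK (hp : p ≠ 2) :
    ∃ H : AddSubgroup (W.baseChange K).toAffine.Point,
      (H : Set (W.baseChange K).toAffine.Point) = {P | P = 0 ∨ W.SatisfiesLocalConditionsK p K P} := by
  refine ⟨(⨅ ι : K →+* ℚ_[p], kernelOfReductionAtEmb W K ι) ⊓
    ⨅ v : HeightOneSpectrum (𝓞 K), nonsingularReductionSubgroupAtPlace W K v, ?_⟩
  ext P
  rw [SetLike.mem_coe, AddSubgroup.mem_inf, AddSubgroup.mem_iInf, AddSubgroup.mem_iInf,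
    Set.mem_setOf_eq]
  rcases P with _ | ⟨x, y, h⟩
  · simp only [WeierstrassCurve.Affine.Point.zero_def, true_or, iff_true]
    exact ⟨fun ι => AddSubgroup.zero_mem _, fun v => AddSubgroup.zero_mem _⟩
  · constructor
    · rintro ⟨hx, hns⟩
      refine Or.inr ⟨fun ι => ?_, fun v => (some_mem_nonsingularReductionSubgroupAtPlace_iff v h).mp (hns v)⟩
      have hι := (some_mem_kernelOfReductionAtEmb_iff ι h).mp (hx ι)
      exact ⟨hι, (inSigmaDisc_of_one_lt_norm_emb hp ι h hι).2⟩
    · rintro (h0 | ⟨hx, hns⟩)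
      · exact (WeierstrassCurve.Affine.Point.some_ne_zero h h0).elim
      · exact ⟨fun ι => (some_mem_kernelOfReductionAtEmb_iff ι h).mpr (hx ι).1,
          fun v => (some_mem_nonsingularReductionSubgroupAtPlace_iff v h).mpr (hns v)⟩

/-! ### `E(K) ∩ E₁` at an embedding is torsion-free for `p` odd (division polynomials) -/

section Torsion

open Polynomial

variable {W K} in
/-- `W ⊗ K` is integral for the valuation ring of `‖ι ·‖_p` (the hypothesis of
`GoodReductionInertia.lean`). [folklore] -/
theorem isIntegral_integer_embValuation (ι : K →+* ℚ_[p]) :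
    (W.baseChange K).IsIntegral (embValuation ι).integer :=
  ⟨⟨⟨(W.baseChange K).a₁,
      (valuation_coeff_baseChange_le_one W K (embValuation ι) (embValuation_intCast_le_one ι)).1⟩,
    ⟨(W.baseChange K).a₂,
      (valuation_coeff_baseChange_le_one W K (embValuation ι) (embValuation_intCast_le_one ι)).2.1⟩,
    ⟨(W.baseChange K).a₃,
      (valuation_coeff_baseChange_le_one W K (embValuation ι) (embValuation_intCast_le_one ι)).2.2.1⟩,
    ⟨(W.baseChange K).a₄,
      (valuation_coeff_baseChange_le_one W K (embValuation ι) (embValuation_intCast_le_one ι)).2.2.2.1⟩,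
    ⟨(W.baseChange K).a₆,
      (valuation_coeff_baseChange_le_one W K (embValuation ι) (embValuation_intCast_le_one ι)).2.2.2.2⟩⟩,
    rfl⟩

variable {W K} in
/-- **A point of `E(K)` in `E₁` at `ι` has `‖ι x‖_p ≥ p²`** (`3 ord(x) = 2 ord(y)`, so `ord x` is
even and negative). [Silverman AEC VII.2.2 (`3v(x) = 2v(y)`)] [folklore] -/
theorem sq_le_norm_of_one_lt_norm_emb (ι : K →+* ℚ_[p]) {x y : K}
    (h : (W.baseChange K).toAffine.Nonsingular x y) (hx : 1 < ‖ι x‖) :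
    (p : ℝ) ^ 2 ≤ ‖ι x‖ := by
  have hv := valuation_integers_valuationSubring (embValuation ι)
  have h1 : ((embIntModel W K ι).baseChange K).toAffine.Equation x y := h.1
  have hx' : 1 < embValuation ι x := (one_lt_embValuation_iff ι x).mpr hx
  obtain ⟨hxy, hsq⟩ := v_X_lt_v_Y_of_one_lt hv h1 hx'
  have hsq' : ‖ι y‖ ^ 2 = ‖ι x‖ ^ 3 := by
    have := congrArg (fun t : NNReal => (t : ℝ)) hsq
    simpa only [embValuation_apply, NNReal.coe_pow, coe_nnnorm] using this
  have hx0 : ι x ≠ 0 := by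
    rintro h0; rw [h0, norm_zero] at hx; exact not_lt.mpr zero_le_one hx
  have hy0 : ι y ≠ 0 := by
    rintro h0; rw [h0, norm_zero, zero_pow two_ne_zero] at hsq'
    exact pow_ne_zero 3 (norm_ne_zero_iff.mpr hx0) hsq'.symm
  have hp1 : (1 : ℝ) < p := by exact_mod_cast (Fact.out : p.Prime).one_lt
  rw [Padic.norm_eq_zpow_neg_valuation hx0] at hx hsq' ⊢
  rw [Padic.norm_eq_zpow_neg_valuation hy0, ← zpow_natCast, ← zpow_natCast, ← zpow_mul,
    ← zpow_mul] at hsq'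
  have hexp := zpow_right_injective₀ (zero_lt_one.trans hp1) hp1.ne' hsq'
  have hneg : 0 < -(ι x).valuation := (one_lt_zpow_iff_right₀ hp1).mp hx
  rw [← zpow_natCast]
  exact zpow_le_zpow_right₀ hp1.le (by push_cast at hexp ⊢; omega)

variable {W K} in
/-- **`E(K) ∩ E₁` at `ι : K → ℚ_p` has no torsion for `p` odd** (AEC VII.3.4 / IV.6.1 for `ℚ_p`,
through the embedding), by division polynomials as in the `ℚ`-case
(`not_isOfFinAddOrder_of_one_lt_padicNorm_holds`): a torsion point of `E₁` has a multiple
`R = (x', y') ∈ E₁` of prime order `q`; for `q ≠ p` this contradicts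
`val_le_one_of_zsmul_eq_zero` (`ΨSq_q` has unit leading coefficient), and for `q = p` odd
`ψ_p(x') = 0` with `ψ_p = p x^{(p²-1)/2} + (integral lower terms)`, whose leading term dominates
because `‖ι x'‖_p ≥ p²`. [Silverman AEC VII.3.4, IV.6.1 (statement); Exercise 3.7 (method)]
[cite: SilvermanAEC2009, VII.3.4] -/
theorem not_isOfFinAddOrder_of_one_lt_norm_emb [(W.baseChange K).IsElliptic] (hp : 3 ≤ p)
    (ι : K →+* ℚ_[p]) {x y : K} (h : (W.baseChange K).toAffine.Nonsingular x y)
    (hx : 1 < ‖ι x‖) : ¬ IsOfFinAddOrder (.some x y h : (W.baseChange K).toAffine.Point) := by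
  intro hfin
  haveI : (W.baseChange K).IsIntegral (embValuation ι).integer := isIntegral_integer_embValuation ι
  have hprime : p.Prime := Fact.out
  -- a multiple of prime order, still in `E₁`
  set P : (W.baseChange K).toAffine.Point := .some x y h with hPdef
  have hN : 0 < addOrderOf P := hfin.addOrderOf_pos
  have hN1 : addOrderOf P ≠ 1 := by
    rw [Ne, AddMonoid.addOrderOf_eq_one_iff]; exact WeierstrassCurve.Affine.Point.some_ne_zero h
  obtain ⟨q, hq, hqN⟩ := Nat.exists_prime_and_dvd hN1
  obtain ⟨m, hm⟩ := hqN
  have hm0 : m ≠ 0 := by rintro rfl; rw [mul_zero] at hm; omega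
  have hmlt : m < addOrderOf P := by
    rw [hm]; exact lt_mul_left (Nat.pos_of_ne_zero hm0) hq.one_lt
  set R := m • P with hRdef
  have hR0 : R ≠ 0 := nsmul_ne_zero_of_lt_addOrderOf hm0 hmlt
  have hqR : q • R = 0 := by
    rw [hRdef, ← mul_nsmul, Nat.mul_comm m q, ← hm]; exact addOrderOf_nsmul_eq_zero P
  have hRmem : R ∈ kernelOfReductionAtEmb W K ι :=
    AddSubgroup.nsmul_mem _ ((some_mem_kernelOfReductionAtEmb_iff ι h).mpr hx) m
  rcases hR : R with _ | ⟨x', y', h'⟩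
  · exact hR0 hR
  rw [hR] at hRmem hqR
  have hx' : 1 < ‖ι x'‖ := (some_mem_kernelOfReductionAtEmb_iff ι h').mp hRmem
  have hqR' : (q : ℤ) • (.some x' y' h' : (W.baseChange K).toAffine.Point) = 0 := by rw [natCast_zsmul]; exact hqR
  by_cases hqp : q = p
  · -- `q = p`: `ψ_p(x') = 0`, impossible by dominance of `p x'^{(p²-1)/2}`
    subst hqp
    have hΨ : ((W.baseChange K).ΨSq q).eval x' = 0 := ((W.baseChange K).zsmul_some_eq_zero_iff_eval_ΨSq h' q).mp hqR'
    have hodd : ¬ Even q := fun he => by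
      have := hq.even_iff.mp he; omega
    rw [WeierstrassCurve.ΨSq_ofNat, if_neg hodd, mul_one, eval_pow, pow_eq_zero_iff two_ne_zero] at hΨ
    -- integrality, degree and leading coefficient of `preΨ' q`
    set d := (q ^ 2 - 1) / 2 with hd
    have hdeg : ((W.baseChange K).preΨ' q).natDegree ≤ d := by
      have := (W.baseChange K).natDegree_preΨ'_le q; rwa [if_neg hodd] at this
    have hlead : ((W.baseChange K).preΨ' q).coeff d = q := by
      have := (W.baseChange K).coeff_preΨ' q; rw [if_neg hodd, if_neg hodd] at this; exact this
    have hcoeff : ∀ i, embValuation ι (((W.baseChange K).preΨ' q).coeff i) ≤ 1 := fun i => by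
      obtain ⟨M, hM⟩ := (inferInstance : (W.baseChange K).IsIntegral (embValuation ι).integer).integral
      have hmap : (W.baseChange K).preΨ' q = (M.preΨ' q).map (algebraMap (embValuation ι).integer K) := by
        rw [← WeierstrassCurve.map_preΨ', hM, WeierstrassCurve.baseChange]
      rw [hmap, coeff_map]
      exact ((M.preΨ' q).coeff i).2
    have hx1 : 1 ≤ embValuation ι x' := ((one_lt_embValuation_iff ι x').mpr hx').le
    have hdom : 1 < embValuation ι (((W.baseChange K).preΨ' q).coeff d) * embValuation ι x' := by
      rw [hlead, embValuation_apply, embValuation_apply, ← NNReal.coe_lt_coe, NNReal.coe_one,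
        NNReal.coe_mul, coe_nnnorm, coe_nnnorm, map_natCast, Padic.norm_p]
      have hp0 : (0 : ℝ) < q := by exact_mod_cast hq.pos
      have h2q : (2 : ℝ) ≤ q := by exact_mod_cast hq.two_le
      have h2 := sq_le_norm_of_one_lt_norm_emb ι h' hx'
      rw [inv_mul_eq_div, lt_div_iff₀ hp0, one_mul]
      nlinarith
    have hval := val_eval_eq_mul_pow hcoeff hdeg hx1 hdom
    rw [hΨ, map_zero] at hval
    have hc : 0 < embValuation ι (((W.baseChange K).preΨ' q).coeff d) := by
      refine pos_of_ne_zero fun h0 => ?_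
      rw [h0, zero_mul] at hdom
      exact not_lt_of_ge zero_le_one hdom
    exact (mul_pos hc (pow_pos (zero_lt_one.trans_le hx1) d)).ne hval
  · -- `q ≠ p`: `ΨSq_q` has unit leading coefficient (`val_le_one_of_zsmul_eq_zero`)
    have hwq : embValuation ι ((q : ℤ) : K) = 1 := by
      rw [embValuation_apply, ← NNReal.coe_eq_one, coe_nnnorm, Int.cast_natCast, map_natCast,
        Padic.norm_natCast_eq_one_iff]
      exact (Nat.coprime_primes hprime hq).mpr (Ne.symm hqp)
    have := val_le_one_of_zsmul_eq_zero (V := W.baseChange K) hwq hqR'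
    rw [embValuation_apply, ← NNReal.coe_le_coe, NNReal.coe_one, coe_nnnorm] at this
    exact absurd hx' (not_lt.mpr this)

end Torsion

end Subgroups

end Literature.NumberTheory.EllipticCurves
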